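import Literature.NumberTheory.NumberFields.EisensteinFieldSelmer
import Literature.NumberTheory.NumberFields.EisensteinFieldPrimes
import HarnessLib

/-!
# `K(S, 3)` of `ℚ(ζ₃)` for `S = {λ} ∪ {q : q ∣ N}`, `N` a product of inert rational primes:
# normal forms `±ζ^i λ^j (∏_{q ∣ N} q^{e_q}) w³`

Topic `NumberTheory/NumberFields`. Uniform version of `EisensteinFieldSelmer330.lean` (`S = {λ, 2, 5}`) and
`EisensteinFieldSelmerTwoInert.lean` (`S = {λ, 2, p, q}`): for ANY natural number `N ≠ 0` all of whose prime factors
`q` stay prime in `𝓞 K3 = ℤ[ζ₃]` — i.e. `q = 2` or `q ≡ 2 (mod 3)` (Ireland–Rosen 9.1.4) — the finite group of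
`b ∈ K3ˣ/K3ˣ³` with `3 ∣ ord_v(b)` for all `v ∤ 3N` is made explicit. This is the `K(S, 3)` met by the
`√−3`-descent on the Mordell curves `y² = x³ + t²`, `N = 2t`, `t` odd with all prime factors `≡ 2 (mod 3)`
(Jeong 2019, §3: `t = pq`; the general `t` is treated in `XCubeAddTSqThreeDescent.lean`).

* `K3.prime_natCast_of_two_or_inert`: `q = 2` or `q ≡ 2 (mod 3)` prime ⇒ `(q : 𝓞 K3)` is prime;
* `K3.associated_of_prime_of_dvd_three_mul`: a prime element dividing `3N` is associated to `λ` or to some `q ∣ N`;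
* `K3.exists_normal_form_inert`: if `3 ∣ ord_v(b)` for all finite places `v ∌ 3N`, then
  `b = s ζ^i (ζ − 1)^j (∏_{q ∈ N.primeFactors} q^{e q}) w³` with `s = ±1`, `i, j, e q < 3`, `w ≠ 0`;
* valuations of such a normal form at `λ` and at each `q ∣ N`, the extraction lemmas
  (`j_eq_zero_of_dvd_inert`, `exp_eq_zero_of_dvd_inert`), `χ₂ = i` for `j = 0` (`chi2_normalForm_inert`), and the class
  modulo cubes (`cubeClass_normalForm_inert(_of_i_j_eq_zero)`: for `i = j = 0` the class of the NATURAL number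
  `∏ q^{e q}`);
* `K3.prodPow_injective_inert`: `e ↦ [∏_{q ∣ N} q^{e q}]` is injective on exponent vectors `e : N.primeFactors → Fin 3`
  (valuations at the `q`), so the box `{[∏ q^{e q}]}` has exactly `3^{ω(N)}` elements (`natCard_range_prodPow_inert`).

## References

* J. H. Silverman, *The Arithmetic of Elliptic Curves*, 2nd ed., GTM 106 (2009), Prop. VIII.1.6, Prop. X.4.9.
  [SilvermanAEC2009]
* K. Ireland, M. Rosen, *A Classical Introduction to Modern Number Theory*, 2nd ed., GTM 84 (1990), Prop. 9.1.4,
  Ch. 9 §3. [IrelandRosen1990]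
* K. Jeong, *Infinitely many elliptic curves of rank exactly two II*, Proc. Japan Acad. 95 (2019), §3.
  [Jeong2019RankExactlyTwoII]
-/

noncomputable section

open QuadraticAlgebra NumberField IsDedekindDomain IsDedekindDomain.HeightOneSpectrum
open WithZero (log exp)
open scoped WithZero
open Literature.NumberTheory.EllipticCurves.MordellDescent (cubeClass CubeUnits cubeClass_mul
  cubeClass_neg cubeClass_mul_pow_three cubeClass_eq_cubeClass_iff)

namespace Literature.NumberTheory.NumberFields

namespace K3

section Inert

variable {N : ℕ} (hN0 : N ≠ 0) (hN : ∀ q ∈ N.primeFactors, q = 2 ∨ q % 3 = 2)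

/-- **Inert rational primes**: a rational prime `q` with `q = 2` or `q ≡ 2 (mod 3)` is a prime element of `𝓞 K3`
(cast from `ℕ`). [cite: IrelandRosen1990, Prop. 9.1.4] -/
theorem prime_natCast_of_two_or_inert {q : ℕ} (hq : q.Prime) (h : q = 2 ∨ q % 3 = 2) :
    Prime ((q : ℕ) : 𝓞 K3) := by
  rcases h with rfl | h3
  · exact prime_natCast_two
  · have h := prime_natCast_of_mod_three_eq_two hq h3
    simpa using h

include hN in
/-- Every prime factor of `N` is a prime element of `𝓞 K3`. [cite: IrelandRosen1990, Prop. 9.1.4] -/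
theorem prime_natCast_of_mem_primeFactors {q : ℕ} (hq : q ∈ N.primeFactors) : Prime ((q : ℕ) : 𝓞 K3) :=
  prime_natCast_of_two_or_inert (Nat.prime_of_mem_primeFactors hq) (hN q hq)

include hN0 hN in
/-- `3 ∤ N` when all prime factors of `N` are `2` or `≡ 2 (mod 3)` (`3` is the ramified prime). [cite: IrelandRosen1990, Prop. 9.1.4] -/
theorem not_three_dvd_of_inert : ¬ 3 ∣ N := by
  intro h3
  have hmem : 3 ∈ N.primeFactors := Nat.mem_primeFactors.mpr ⟨Nat.prime_three, h3, hN0⟩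
  rcases hN 3 hmem with h | h <;> omega

include hN0 hN in
/-- `3 ∤ q` for a prime factor `q` of such an `N` (inert primes are prime to the ramified `3`). [cite: IrelandRosen1990, Prop. 9.1.4] -/
theorem not_three_dvd_of_mem_primeFactors {q : ℕ} (hq : q ∈ N.primeFactors) : ¬ 3 ∣ q := fun h =>
  not_three_dvd_of_inert hN0 hN (h.trans (Nat.dvd_of_mem_primeFactors hq))

/-- **A prime element of `𝓞 K3` dividing `3` is associated to `λ`** (`3 = −ζ²λ²`). [cite: IrelandRosen1990, Prop. 9.1.4] -/
theorem associated_lamInt_of_prime_of_dvd_three {r : 𝓞 K3} (hr : Prime r) (h : r ∣ 3) : Associated r lamInt := by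
  rw [three_eq_neg_zetaInt_sq_mul_lamInt_sq, dvd_neg] at h
  rcases hr.dvd_or_dvd h with hz | hl
  · exfalso
    have hu : IsUnit (zetaInt ^ 2) := (isPrimitiveRoot_zeta.toInteger_isPrimitiveRoot.isUnit (by norm_num)).pow 2
    exact hr.not_unit (isUnit_of_dvd_unit hz hu)
  · exact hr.irreducible.associated_of_dvd prime_lamInt.irreducible (hr.dvd_of_dvd_pow hl)

include hN0 hN in
/-- **A prime element dividing `3N` is associated to `λ` or to some prime factor `q` of `N`** (all of them prime in
`𝓞 K3`). [cite: IrelandRosen1990, Prop. 9.1.4] -/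
theorem associated_of_prime_of_dvd_three_mul {r : 𝓞 K3} (hr : Prime r) (h : r ∣ ((3 * N : ℕ) : 𝓞 K3)) :
    Associated r lamInt ∨ ∃ q ∈ N.primeFactors, Associated r ((q : ℕ) : 𝓞 K3) := by
  have hfac : ((3 * N : ℕ) : 𝓞 K3) = 3 * ∏ q ∈ N.primeFactors, ((q : ℕ) : 𝓞 K3) ^ N.factorization q := by
    conv_lhs => rw [← Nat.prod_factorization_pow_eq_self hN0]
    rw [Nat.cast_mul, Nat.prod_factorization_eq_prod_primeFactors]
    push_cast
    rfl
  rw [hfac] at h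
  rcases hr.dvd_or_dvd h with h3 | hP
  · exact Or.inl (associated_lamInt_of_prime_of_dvd_three hr h3)
  · obtain ⟨q, hq, hdq⟩ := (Prime.dvd_finsetProd_iff hr _).mp hP
    exact Or.inr ⟨q, hq, hr.irreducible.associated_of_dvd (prime_natCast_of_mem_primeFactors hN hq).irreducible
      (hr.dvd_of_dvd_pow hdq)⟩

include hN0 hN in
/-- Every prime element dividing `3N` is associated to one of the generators `λ`, `(q)_{q ∣ N}` (generator form,
indexed by `Option N.primeFactors`). [folklore] -/
private theorem gens_spec_inert (r : 𝓞 K3) (hr : Prime r) (h : r ∣ ((3 * N : ℕ) : 𝓞 K3)) :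
    ∃ i : Option N.primeFactors, Associated r (Option.elim i lamInt (fun q => ((q : ℕ) : 𝓞 K3))) := by
  rcases associated_of_prime_of_dvd_three_mul hN0 hN hr h with h | ⟨q, hq, h⟩
  · exact ⟨none, h⟩
  · exact ⟨some ⟨q, hq⟩, h⟩

include hN0 hN in
/-- **Normal form of `K(S, 3)`, `S = {λ} ∪ {q ∣ N}`** (`N`'s prime factors inert): if `b ∈ K3ˣ` has
`3 ∣ ord_v(b)` for every finite place `v ∌ 3N`, then `b = s ζ^i (ζ − 1)^j (∏_{q ∣ N} q^{e q}) w³` with `s = ±1`,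
`i, j < 3`, `e q < 3`, `w ≠ 0`. [cite: SilvermanAEC2009, Prop. VIII.1.6 (proof)] -/
theorem exists_normal_form_inert {b : K3} (hb : b ≠ 0)
    (hval : ∀ v : HeightOneSpectrum (𝓞 K3), ((3 * N : ℕ) : 𝓞 K3) ∉ v.asIdeal → (3 : ℤ) ∣ log (v.valuation K3 b)) :
    ∃ (s : ℤ) (i j : ℕ) (e : ℕ → ℕ) (w : K3), (s = 1 ∨ s = -1) ∧ i < 3 ∧ j < 3 ∧ (∀ q, e q < 3) ∧ w ≠ 0 ∧
      b = s * zeta ^ i * (zeta - 1) ^ j * (∏ q ∈ N.primeFactors, (q : K3) ^ e q) * w ^ 3 := by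
  classical
  obtain ⟨u, e, w, he, hw, h⟩ := exists_eq_unit_mul_prod_pow_mul_pow (K := K3) ((3 * N : ℕ) : 𝓞 K3)
    (fun i : Option N.primeFactors => Option.elim i lamInt (fun q => ((q : ℕ) : 𝓞 K3))) (gens_spec_inert hN0 hN)
    (n := 3) (by norm_num) hb hval
  obtain ⟨s, i, hs, hi, hu⟩ := exists_coe_unit_eq u
  refine ⟨s, i, e none, fun q => if hq : q ∈ N.primeFactors then e (some ⟨q, hq⟩) else 0, w, hs, hi, he none,
    fun q => ?_, hw, ?_⟩
  · by_cases hq : q ∈ N.primeFactors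
    · dsimp only; rw [dif_pos hq]; exact he _
    · dsimp only; rw [dif_neg hq]; norm_num
  · rw [h, Fintype.prod_option, hu]
    have hprod : (∏ x : N.primeFactors, ((Option.elim (some x) lamInt (fun q => ((q : ℕ) : 𝓞 K3)) : 𝓞 K3) : K3) ^
        e (some x)) = ∏ q ∈ N.primeFactors, (q : K3) ^ (if hq : q ∈ N.primeFactors then e (some ⟨q, hq⟩) else 0) := by
      rw [← Finset.prod_coe_sort N.primeFactors]
      refine Finset.prod_congr rfl fun x _ => ?_
      rw [dif_pos x.2]
      simp only [Option.elim]
      rw [coe_natCast_ringOfIntegers]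
    rw [hprod]
    simp only [Option.elim, coe_lamInt]
    ring

/-! ### Valuations of a normal form -/

/-- `log val_r (∏_{q ∈ s} q^{e q}) = ∑_{q ∈ s} e q · log val_r q` for natural numbers `q ≠ 0` (additivity of `ord_r`).
[cite: SilvermanAEC2009, Prop. X.4.9] -/
theorem log_val_prod_pow {r : 𝓞 K3} (hr : Prime r) (s : Finset ℕ) (e : ℕ → ℕ) (hs : ∀ q ∈ s, q ≠ 0) :
    log (val hr (∏ q ∈ s, (q : K3) ^ e q)) = ∑ q ∈ s, (e q : ℤ) * log (val hr (q : K3)) := by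
  classical
  induction s using Finset.induction_on with
  | empty => simp
  | insert a s ha ih =>
    have hs' : ∀ q ∈ s, q ≠ 0 := fun q hq => hs q (Finset.mem_insert_of_mem hq)
    have ha0 : (a : K3) ≠ 0 := by exact_mod_cast hs a (Finset.mem_insert_self a s)
    have hne : (∏ q ∈ s, (q : K3) ^ e q) ≠ 0 :=
      Finset.prod_ne_zero_iff.mpr fun q hq => pow_ne_zero _ (by exact_mod_cast hs' q hq)
    rw [Finset.prod_insert ha, Finset.sum_insert ha, Valuation.log_map_mul _ (pow_ne_zero _ ha0) hne,
      Valuation.log_map_pow, ih hs']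

/-- The prime-power product `∏_{q ∣ N} q^{e q}` of a normal form is non-zero. [cite: SilvermanAEC2009, Prop. X.4.9] -/
theorem prodPow_ne_zero (e : ℕ → ℕ) : (∏ q ∈ N.primeFactors, (q : K3) ^ e q) ≠ 0 :=
  Finset.prod_ne_zero_iff.mpr fun q hq => pow_ne_zero _ (by exact_mod_cast (Nat.prime_of_mem_primeFactors hq).ne_zero)

section Valuations

variable {s : ℤ} (hs : s = 1 ∨ s = -1) (i j : ℕ) (e : ℕ → ℕ) {w : K3} (hw : w ≠ 0)
include hs hw

/-- A normal form is non-zero. [cite: SilvermanAEC2009, Prop. X.4.9] -/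
theorem normalForm_inert_ne_zero :
    (s : K3) * zeta ^ i * (zeta - 1) ^ j * (∏ q ∈ N.primeFactors, (q : K3) ^ e q) * w ^ 3 ≠ 0 := by
  have hs0 : (s : K3) ≠ 0 := by rcases hs with rfl | rfl <;> norm_num
  have hz : (zeta : K3) ≠ 0 := isPrimitiveRoot_zeta.ne_zero (by norm_num)
  exact mul_ne_zero (mul_ne_zero (mul_ne_zero (mul_ne_zero hs0 (pow_ne_zero _ hz))
    (pow_ne_zero _ zeta_sub_one_ne_zero)) (prodPow_ne_zero e)) (pow_ne_zero _ hw)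

/-- Generic valuation of a normal form at a prime element `r` (additivity of `ord_r`). [cite: SilvermanAEC2009, Prop. X.4.9] -/
theorem log_val_normalForm_inert {r : 𝓞 K3} (hr : Prime r) :
    log (val hr ((s : K3) * zeta ^ i * (zeta - 1) ^ j * (∏ q ∈ N.primeFactors, (q : K3) ^ e q) * w ^ 3)) =
      j * log (val hr (zeta - 1)) + (∑ q ∈ N.primeFactors, (e q : ℤ) * log (val hr (q : K3))) + 3 * log (val hr w) := by
  have hs0 : (s : K3) ≠ 0 := by rcases hs with rfl | rfl <;> norm_num
  have hz : (zeta : K3) ≠ 0 := isPrimitiveRoot_zeta.ne_zero (by norm_num)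
  have h1 : (s : K3) * zeta ^ i ≠ 0 := mul_ne_zero hs0 (pow_ne_zero _ hz)
  have h2 : (s : K3) * zeta ^ i * (zeta - 1) ^ j ≠ 0 := mul_ne_zero h1 (pow_ne_zero _ zeta_sub_one_ne_zero)
  have h3 : (s : K3) * zeta ^ i * (zeta - 1) ^ j * (∏ q ∈ N.primeFactors, (q : K3) ^ e q) ≠ 0 :=
    mul_ne_zero h2 (prodPow_ne_zero e)
  rw [Valuation.log_map_mul _ h3 (pow_ne_zero _ hw), Valuation.log_map_mul _ h2 (prodPow_ne_zero e),
    Valuation.log_map_mul _ h1 (pow_ne_zero _ zeta_sub_one_ne_zero), Valuation.log_map_mul _ hs0 (pow_ne_zero _ hz),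
    Valuation.log_map_pow, Valuation.log_map_pow, Valuation.log_map_pow, log_val_sign hr hs, log_val_zeta hr,
    log_val_prod_pow hr _ _ (fun q hq => (Nat.prime_of_mem_primeFactors hq).ne_zero)]
  ring

include hN0 hN in
/-- **At `λ`**: `log vL = −j + 3 log vL(w)` (every `q ∣ N` is prime to `3`). [cite: SilvermanAEC2009, Prop. X.4.9] -/
theorem log_vL_normalForm_inert :
    log (vL ((s : K3) * zeta ^ i * (zeta - 1) ^ j * (∏ q ∈ N.primeFactors, (q : K3) ^ e q) * w ^ 3)) =
      -j + 3 * log (vL w) := by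
  rw [vL, log_val_normalForm_inert hs i j e hw prime_lamInt, ← coe_lamInt, log_val_self]
  have hsum : ∑ q ∈ N.primeFactors, (e q : ℤ) * log (val prime_lamInt (q : K3)) = 0 :=
    Finset.sum_eq_zero fun q hq => by rw [log_val_lam_natCast (not_three_dvd_of_mem_primeFactors hN0 hN hq), mul_zero]
  rw [hsum]
  ring

include hN in
/-- **At a prime factor `q₀` of `N`**: `log val_{q₀} = −e q₀ + 3 log val_{q₀}(w)`. [cite: SilvermanAEC2009, Prop. X.4.9] -/
theorem log_valq_normalForm_inert {q₀ : ℕ} (hq₀ : q₀ ∈ N.primeFactors) :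
    log (val (prime_natCast_of_mem_primeFactors hN hq₀)
        ((s : K3) * zeta ^ i * (zeta - 1) ^ j * (∏ q ∈ N.primeFactors, (q : K3) ^ e q) * w ^ 3)) =
      -(e q₀ : ℤ) + 3 * log (val (prime_natCast_of_mem_primeFactors hN hq₀) w) := by
  haveI : Fact q₀.Prime := ⟨Nat.prime_of_mem_primeFactors hq₀⟩
  rw [log_val_normalForm_inert hs i j e hw (prime_natCast_of_mem_primeFactors hN hq₀), log_val_zeta_sub_one,
    Finset.sum_eq_single q₀ (fun q hq hne => ?_) (fun h => (h hq₀).elim), log_val_natCast_self]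
  · ring
  · have hnd : ¬ q₀ ∣ q := fun h =>
      hne ((Nat.prime_dvd_prime_iff_eq (Nat.prime_of_mem_primeFactors hq₀) (Nat.prime_of_mem_primeFactors hq)).mp h).symm
    rw [log_val_natCast_of_not_dvd _ hnd, mul_zero]

include hN0 hN in
/-- `3 ∣ log vL ⟹ j = 0` (`j < 3`). [cite: SilvermanAEC2009, Prop. X.4.9] -/
theorem j_eq_zero_of_dvd_inert (hj : j < 3)
    (h : (3 : ℤ) ∣ log (vL ((s : K3) * zeta ^ i * (zeta - 1) ^ j * (∏ q ∈ N.primeFactors, (q : K3) ^ e q) * w ^ 3))) :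
    j = 0 := by
  rw [log_vL_normalForm_inert hN0 hN hs i j e hw] at h; omega

include hN in
/-- `3 ∣ log val_{q₀} ⟹ e q₀ = 0` (`e q₀ < 3`). [cite: SilvermanAEC2009, Prop. X.4.9] -/
theorem exp_eq_zero_of_dvd_inert {q₀ : ℕ} (hq₀ : q₀ ∈ N.primeFactors) (he : e q₀ < 3)
    (h : (3 : ℤ) ∣ log (val (prime_natCast_of_mem_primeFactors hN hq₀)
      ((s : K3) * zeta ^ i * (zeta - 1) ^ j * (∏ q ∈ N.primeFactors, (q : K3) ^ e q) * w ^ 3))) : e q₀ = 0 := by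
  rw [log_valq_normalForm_inert hN hs i j e hw hq₀] at h; omega

end Valuations

/-! ### The residue character at `2` of a normal form with `j = 0` -/

/-- `χ₂` kills every product of powers of natural numbers. [cite: IrelandRosen1990, Ch. 9 §3] -/
theorem chi2_prodPow (s : Finset ℕ) (e : ℕ → ℕ) (hs : ∀ q ∈ s, q ≠ 0) : chi2 (∏ q ∈ s, (q : K3) ^ e q) = 0 := by
  classical
  induction s using Finset.induction_on with
  | empty => rw [Finset.prod_empty]; exact chi_one _ cubicChar_mul_two
  | insert a s ha ih =>
    have hs' : ∀ q ∈ s, q ≠ 0 := fun q hq => hs q (Finset.mem_insert_of_mem hq)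
    have ha0 : (a : K3) ≠ 0 := by exact_mod_cast hs a (Finset.mem_insert_self a s)
    have hne : (∏ q ∈ s, (q : K3) ^ e q) ≠ 0 :=
      Finset.prod_ne_zero_iff.mpr fun q hq => pow_ne_zero _ (by exact_mod_cast hs' q hq)
    rw [Finset.prod_insert ha, chi2, chi_mul _ cubicChar_mul_two (pow_ne_zero _ ha0) hne, chi_pow _ cubicChar_mul_two ha0,
      chi_natCast _ cubicChar_ratCast_two, mul_zero, zero_add, ← chi2, ih hs']

section Characters

variable {s : ℤ} (hs : s = 1 ∨ s = -1) (i : ℕ) (e : ℕ → ℕ) {w : K3} (hw : w ≠ 0)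
include hs hw

/-- **`χ₂` of a normal form** (`j = 0`): `χ₂ = i` (`χ₂(ζ) = 1`, `χ₂(ℚˣ) = 0`, `χ₂(w³) = 0`).
[cite: IrelandRosen1990, Ch. 9 §3] -/
theorem chi2_normalForm_inert :
    chi2 ((s : K3) * zeta ^ i * (∏ q ∈ N.primeFactors, (q : K3) ^ e q) * w ^ 3) = i := by
  have hs0 : (s : K3) ≠ 0 := by rcases hs with rfl | rfl <;> norm_num
  have hz : (zeta : K3) ≠ 0 := isPrimitiveRoot_zeta.ne_zero (by norm_num)
  have H := cubicChar_mul_two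
  have R := cubicChar_ratCast_two
  have h1 : (s : K3) * zeta ^ i ≠ 0 := mul_ne_zero hs0 (pow_ne_zero _ hz)
  have h3 : (s : K3) * zeta ^ i * (∏ q ∈ N.primeFactors, (q : K3) ^ e q) ≠ 0 := mul_ne_zero h1 (prodPow_ne_zero e)
  rw [chi2, chi_mul _ H h3 (pow_ne_zero _ hw), chi_mul _ H h1 (prodPow_ne_zero e), chi_mul _ H hs0 (pow_ne_zero _ hz),
    chi_intCast _ R, chi_pow _ H hz, chi_pow_three _ H hw, ← chi2, chi2_zeta,
    chi2_prodPow _ _ (fun q hq => (Nat.prime_of_mem_primeFactors hq).ne_zero)]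
  ring

end Characters

/-! ### Classes modulo cubes -/

/-- **The class of a normal form**: `[s ζ^i λ^j P w³] = [ζ^i λ^j P]`, `P = ∏ q^{e q}`. [cite: SilvermanAEC2009, Prop. X.4.9] -/
theorem cubeClass_normalForm_inert {s : ℤ} (hs : s = 1 ∨ s = -1) (i j : ℕ) (e : ℕ → ℕ) {w : K3} (hw : w ≠ 0) :
    cubeClass ((s : K3) * zeta ^ i * (zeta - 1) ^ j * (∏ q ∈ N.primeFactors, (q : K3) ^ e q) * w ^ 3) =
      cubeClass (zeta ^ i * (zeta - 1) ^ j * (∏ q ∈ N.primeFactors, (q : K3) ^ e q) : K3) := by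
  have hz : (zeta : K3) ≠ 0 := isPrimitiveRoot_zeta.ne_zero (by norm_num)
  have hm : (zeta ^ i * (zeta - 1) ^ j * (∏ q ∈ N.primeFactors, (q : K3) ^ e q) : K3) ≠ 0 :=
    mul_ne_zero (mul_ne_zero (pow_ne_zero _ hz) (pow_ne_zero _ zeta_sub_one_ne_zero)) (prodPow_ne_zero e)
  rw [show (s : K3) * zeta ^ i * (zeta - 1) ^ j * (∏ q ∈ N.primeFactors, (q : K3) ^ e q) * w ^ 3 =
      (s * (zeta ^ i * (zeta - 1) ^ j * (∏ q ∈ N.primeFactors, (q : K3) ^ e q))) * w ^ 3 by ring,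
    cubeClass_mul_pow_three (mul_ne_zero (by rcases hs with rfl | rfl <;> norm_num) hm) hw]
  rcases hs with rfl | rfl
  · rw [Int.cast_one, one_mul]
  · rw [Int.cast_neg, Int.cast_one, neg_one_mul, cubeClass_neg]

/-- **The box classes**: a normal form with `i = j = 0` has class `[∏ q^{e q}]`, the class of the NATURAL number
`∏_{q ∣ N} q^{e q}`. [cite: Jeong2019RankExactlyTwoII, Lemma 3.3] -/
theorem cubeClass_normalForm_inert_of_i_j_eq_zero {s : ℤ} (hs : s = 1 ∨ s = -1) (e : ℕ → ℕ) {w : K3} (hw : w ≠ 0) :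
    cubeClass ((s : K3) * zeta ^ 0 * (zeta - 1) ^ 0 * (∏ q ∈ N.primeFactors, (q : K3) ^ e q) * w ^ 3) =
      cubeClass (((∏ q ∈ N.primeFactors, q ^ e q : ℕ) : ℚ) : K3) := by
  rw [cubeClass_normalForm_inert hs 0 0 e hw, pow_zero, pow_zero, one_mul, one_mul]
  congr 1
  push_cast
  rfl

/-! ### The box `{[∏ q^{e q}] : e q < 3}` has `3^{ω(N)}` elements -/

include hN in
/-- **The box classes are distinct**: `e ↦ [∏_{q ∣ N} q^{e q}]` is injective on exponent vectors
`e : N.primeFactors → Fin 3` (valuations at the `q ∣ N`). [cite: SilvermanAEC2009, Prop. X.4.9] -/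
theorem prodPow_injective_inert :
    Function.Injective (fun e : N.primeFactors → Fin 3 =>
      cubeClass (∏ q ∈ N.primeFactors.attach, ((q : ℕ) : K3) ^ (e q : ℕ))) := by
  intro e e' h
  -- rewrite both products as normal forms with exponent functions on `ℕ`
  classical
  set E : ℕ → ℕ := fun q => if hq : q ∈ N.primeFactors then (e ⟨q, hq⟩ : ℕ) else 0 with hE
  set E' : ℕ → ℕ := fun q => if hq : q ∈ N.primeFactors then (e' ⟨q, hq⟩ : ℕ) else 0 with hE'
  have hP : ∀ (f : N.primeFactors → Fin 3),
      (∏ q ∈ N.primeFactors.attach, ((q : ℕ) : K3) ^ (f q : ℕ)) =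
        ∏ q ∈ N.primeFactors, (q : K3) ^ (fun q => if hq : q ∈ N.primeFactors then (f ⟨q, hq⟩ : ℕ) else 0) q := by
    intro f
    rw [← Finset.prod_coe_sort N.primeFactors]
    refine Finset.prod_congr rfl fun x _ => ?_
    simp only [dif_pos x.2]
  have h' : cubeClass (∏ q ∈ N.primeFactors, (q : K3) ^ E q) = cubeClass (∏ q ∈ N.primeFactors, (q : K3) ^ E' q) := by
    have := h
    simp only at this
    rwa [hP e, hP e'] at this
  obtain ⟨w, hw, hww⟩ := (cubeClass_eq_cubeClass_iff (prodPow_ne_zero E) (prodPow_ne_zero E')).mp h'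
  funext x
  obtain ⟨q₀, hq₀⟩ := x
  have hnf : ∀ (f : ℕ → ℕ) (z : K3), (∏ q ∈ N.primeFactors, (q : K3) ^ f q) * z ^ 3 =
      ((1 : ℤ) : K3) * zeta ^ 0 * (zeta - 1) ^ 0 * (∏ q ∈ N.primeFactors, (q : K3) ^ f q) * z ^ 3 := by
    intro f z; push_cast; ring
  have hlhs : (∏ q ∈ N.primeFactors, (q : K3) ^ E q) =
      ((1 : ℤ) : K3) * zeta ^ 0 * (zeta - 1) ^ 0 * (∏ q ∈ N.primeFactors, (q : K3) ^ E q) * 1 ^ 3 := by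
    push_cast; ring
  have hv := congrArg (fun x => log (val (prime_natCast_of_mem_primeFactors hN hq₀) x)) hww
  rw [hlhs, hnf, log_valq_normalForm_inert hN (Or.inl rfl) 0 0 E one_ne_zero hq₀,
    log_valq_normalForm_inert hN (Or.inl rfl) 0 0 E' hw hq₀, Valuation.map_one, WithZero.log_one] at hv
  have h1 : E q₀ = (e ⟨q₀, hq₀⟩ : ℕ) := by simp only [hE, dif_pos hq₀]
  have h2 : E' q₀ = (e' ⟨q₀, hq₀⟩ : ℕ) := by simp only [hE', dif_pos hq₀]
  have hk := (e ⟨q₀, hq₀⟩).isLt; have hk' := (e' ⟨q₀, hq₀⟩).isLt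
  rw [h1, h2] at hv
  exact Fin.ext (by omega)

include hN in
/-- **The box has `3^{ω(N)}` elements** (`ω(N) = #N.primeFactors`). [cite: Jeong2019RankExactlyTwoII, Lemma 3.3] -/
theorem natCard_range_prodPow_inert :
    Nat.card (Set.range (fun e : N.primeFactors → Fin 3 =>
      cubeClass (∏ q ∈ N.primeFactors.attach, ((q : ℕ) : K3) ^ (e q : ℕ)))) = 3 ^ N.primeFactors.card := by
  rw [Nat.card_range_of_injective (prodPow_injective_inert hN), Nat.card_eq_fintype_card, Fintype.card_fun,
    Fintype.card_fin, Fintype.card_coe]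

end Inert

end K3

end Literature.NumberTheory.NumberFields
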